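import Summits.BirchSwinnertonDyer.BirchSwinnertonDyer.Theorems.ResidualThetaTransportAtTwoRlfTwistedCoresWitness
import Literature.NumberTheory.GaloisRepresentations.HOneRestrictionOntoInvariantsPadic
import HarnessLib

/-!
# Route `ResidualThetaTransportAtTwo` (RTT P6, item stmt-BirchSwinnertonDyer-23110, road T), H-PLUSDUAL / ISO brick (C), layer classes:
# every layer-`J` point class `b ∈ A`, `g^{2^J} b ≡ b (mod 2^J A)`, is the witness point of a `U_J`-cocycle

Width seat `bsd-wall-tp2-p2x-w2` g16 (cell `bsd-wall`), for the LEAD `bsd-wall-tp2-p2x` g12 (skeleton `hplusdual`, stub `stub_iso`).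
HONEST FRAMING: THEOREMS ONLY (no definition, no named fact, no instance, no `sorry`; the layer character `κ_J = 2^{-J}·κ|_{U_J}` is
produced existentially); closes no item; BSD is NOT proved by any of this.

Setting: `W/ℚ` elliptic, `κ` a `ℤ₂`-extension, `v` a place, `ℚ_v`, `Γ_v`, `N = Gal(ℚ̄_v/ℚ_{v,∞}) = localSubgroup (ker κ) ℚ_v`,
`U_J = LayerPairing.layerGroup κ v J`, `g ∈ Γ_v` a local lift of the topological generator, `A = ⋃ₙ E⁺(ℚ_{v,n})`.
This is the layer-`J` twin of `…RlfTwistedLocalKummerCard.exists_witness_of_eigen` (T5 at level `0`): there the twisted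
conjugation `conj_g` on `H¹(N, E[2^J](χ_u))` and `Γ_v/N ≅ ℤ₂`; here the plain conjugation by `g^{2^J}` on `H¹(N, E[2^J])` and
`U_J/N ≅ 2^J ℤ₂ ≅ ℤ₂`.

* §1 `exists_layerCharacter` — the continuous character `κ_J : U_J →ₜ* ℤ₂` with `2^J · κ_J(σ) = κ(res σ)` (division by `2^J` on
  `κ(res U_J) ⊆ 2^J ℤ₂`; continuity through the closed embedding `y ↦ 2^J y`, as in `ZpExtension.exists_zpExtension_shift`);
  its kernel is `N ∩ U_J = N` and `κ_J(g^{2^J}) = 1`.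
* §2 **`exists_layerCocycle_of_layerFixed`** — for `b ∈ A` with `g^{2^J} b − b ∈ 2^J A` there are a continuous `U_J`-cocycle `ψ`
  of the untwisted `E[2^J]|` (`LayerPairing.torsionLocalRep`) and a root `Q`, `2^J Q = b`, with `ψ(τ) = τQ − Q` on points for
  `τ ∈ N`: the Kummer cocycle of a `2^J`-th root `Q` of `b` on `N` has a `g^{2^J}`-invariant class (`g^{2^J}Q − Q ≡ w (mod E[2^J])`
  with `w ∈ A ⊆ E(ℚ_{v,∞})` fixed by `N`), hence extends over `U_J/N ≅ ℤ₂` (`exists_resSubgroup_eq_of_conjMap_eq_of_padicInt`,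
  `cd₂ ℤ₂ = 1`). With `…RlfTwistedCoresWitness.exists_twist_layerCocycle` the same holds for `E[2^J](χ_u)|`.

References: B. D. Kim, Compositio Math. 143 (2007), Prop. 3.15 (proof) and Prop. 4.11 [BDKim2007]; R. Greenberg, LNM 1716 (1999),
§3 p. 86, §4 p. 124 (inflation–restriction for `Γ ≅ ℤ_p`) [GreenbergLNM1716]; J.-P. Serre, *Galois Cohomology* I §2.6 (b)
[SerreGaloisCohomology1997]; L. Washington, *Cyclotomic Fields* §13.1 [Washington1997].
-/

-- the Theorems namespace of this sub repeats the summit name by design (D-0017 nested layout)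
set_option linter.dupNamespace false

noncomputable section

open scoped Classical NumberField
open CategoryTheory Function Field NumberField IsDedekindDomain

namespace Summit.BirchSwinnertonDyer.BirchSwinnertonDyer.Theorems.SignedEC.TwistedLocalKummer

open Literature.NumberTheory.EllipticCurves Literature.NumberTheory.GaloisRepresentations WeierstrassCurve ZpExtension
  Literature.NumberTheory.EllipticCurves.Kobayashi2003 Literature.NumberTheory.EllipticCurves.Sprung2012 SignedKatoOffTwo
open scoped ContRepresentation

universe u

/-! ## §1 The layer character `κ_J = 2^{-J} · κ|_{U_J} : U_J → ℤ₂` -/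

/-- **The layer character.** On `U_J = κ⁻¹(2^J ℤ₂) ∩ Γ_v` the local character `κ ∘ res` is divisible by `2^J`; the quotient
`κ_J` is a continuous homomorphism `U_J →ₜ* ℤ₂` (Washington §13.1: `Gal(K_∞/K_J) = 2^J ℤ₂ ≅ ℤ₂`). [cite: Washington1997, §13.1] -/
theorem exists_layerCharacter (κ : ZpExtension ℚ 2) (v : HeightOneSpectrum (𝓞 ℚ)) (J : ℕ) :
    ∃ κJ : LayerPairing.layerGroup κ v J →ₜ* Multiplicative ℤ_[2],
      ∀ σ : LayerPairing.layerGroup κ v J,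
        (2 : ℤ_[2]) ^ J * (κJ σ).toAdd = (κ (resGal (K := ℚ) (v.adicCompletion ℚ) (σ : absoluteGaloisGroup (v.adicCompletion ℚ)))).toAdd := by
  haveI : Fact (Nat.Prime 2) := ⟨Nat.prime_two⟩
  have hpa : ((2 : ℤ_[2]) ^ J) ≠ 0 := pow_ne_zero _ (Nat.cast_ne_zero.mpr two_ne_zero)
  have hdiv : ∀ σ : LayerPairing.layerGroup κ v J, ∃ y : ℤ_[2],
      (κ (resGal (K := ℚ) (v.adicCompletion ℚ) (σ : absoluteGaloisGroup (v.adicCompletion ℚ)))).toAdd = (2 : ℤ_[2]) ^ J * y := by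
    intro σ
    have hσ : resGal (K := ℚ) (v.adicCompletion ℚ) (σ : absoluteGaloisGroup (v.adicCompletion ℚ)) ∈ κ.layerSubgroup J :=
      (mem_localSubgroupOfEmb_iff _ _ _).mp σ.2
    rw [ZpExtension.mem_layerSubgroup] at hσ
    obtain ⟨y, hy⟩ := hσ
    exact ⟨y, by exact_mod_cast hy⟩
  choose f hf using hdiv
  have hf1 : f 1 = 0 := by
    have h := hf 1
    rw [OneMemClass.coe_one, map_one, map_one, toAdd_one] at h
    rcases mul_eq_zero.mp h.symm with h0 | h0
    · exact absurd h0 hpa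
    · exact h0
  have hfmul : ∀ σ τ, f (σ * τ) = f σ + f τ := by
    intro σ τ
    apply mul_left_cancel₀ hpa
    rw [mul_add, ← hf σ, ← hf τ, ← hf (σ * τ), Subgroup.coe_mul, map_mul, map_mul, toAdd_mul]
  have hm : Topology.IsClosedEmbedding (fun y : ℤ_[2] => (2 : ℤ_[2]) ^ J * y) :=
    (continuous_const.mul continuous_id).isClosedEmbedding (mul_right_injective₀ hpa)
  have hfc : Continuous f := by
    rw [hm.isEmbedding.continuous_iff]
    have hc : Continuous (fun σ : LayerPairing.layerGroup κ v J =>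
        (κ (resGal (K := ℚ) (v.adicCompletion ℚ) (σ : absoluteGaloisGroup (v.adicCompletion ℚ)))).toAdd) :=
      continuous_toAdd.comp ((κ.toContinuousMonoidHom.comp (resGal (K := ℚ) (v.adicCompletion ℚ))).continuous.comp
        continuous_subtype_val)
    convert hc using 1
    ext σ
    exact (hf σ).symm
  let κJ : LayerPairing.layerGroup κ v J →ₜ* Multiplicative ℤ_[2] :=
    { toFun := fun σ => Multiplicative.ofAdd (f σ)
      map_one' := by rw [hf1]; rfl
      map_mul' := fun σ τ => by rw [hfmul, ofAdd_add]
      continuous_toFun := continuous_ofAdd.comp hfc }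
  refine ⟨κJ, fun σ ↦ ?_⟩
  change (2 : ℤ_[2]) ^ J * (Multiplicative.ofAdd (f σ)).toAdd = _
  rw [toAdd_ofAdd, ← hf σ]

/-- Generic bookkeeping: if the restriction of the class of a `G`-cocycle `ξ` to `N` is the class of `c`, then on `N` the values of
`ξ` are those of `c` up to ONE coboundary. [cite: SerreLocalFields1979, VII §5] -/
theorem exists_apply_eq_add_coboundary_of_resSubgroup_eq {G : Type u} [Group G] [TopologicalSpace G] [IsTopologicalGroup G]
    (X : TopRep.{u} ℤ G) (N : Subgroup G) (ξ : contOneCocycles X) (c : contOneCocycles (subgroupRep X N))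
    (h : resSubgroup X N 1 (oneCocycleClass X ξ) = oneCocycleClass _ c) :
    ∃ b : X, ∀ n : N, ξ.1 (n : G) = c.1 n + ((subgroupRep X N).ρ n b - b) := by
  rw [resSubgroup_oneCocycleClass, ← sub_eq_zero, ← oneCocycleClass_sub, oneCocycleClass_eq_zero_iff] at h
  obtain ⟨b, hb⟩ := h
  refine ⟨b, fun n ↦ ?_⟩
  have h1 := hb n
  rw [Submodule.coe_sub, ContinuousMap.sub_apply, resSubgroup_pullback_apply, sub_eq_iff_eq_add'] at h1
  rw [h1, add_comm]

/-! ## §2 Layer point classes are witness points of `U_J`-cocycles -/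

set_option maxHeartbeats 800000 in
-- the many `ContinuousRep`/`TopRep` bridges on the layer group make this one elaboration long (not any single step)
/-- **Layer-`J` point classes come from `U_J`-cocycles** (inflation–restriction for `U_J/N ≅ ℤ₂`, `cd₂ ℤ₂ = 1`). For `W/ℚ`
elliptic, a `ℤ₂`-extension `κ`, `v`, `g ∈ Γ_v` a local lift of the topological generator and `b ∈ A = ⋃ₙ E⁺(ℚ_{v,n})` with
`g^{2^J} b − b ∈ 2^J A`: there are a continuous `U_J`-cocycle `ψ` of `E[2^J]|` (`LayerPairing.torsionLocalRep`) and a root `Q`,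
`2^J Q = b`, with `ψ(τ) = τQ − Q` on points for every `τ ∈ N = Gal(ℚ̄_v/ℚ_{v,∞})` — a layer-`J` witness class with point `b`.
The Kummer cocycle of `Q` on `N` has `g^{2^J}`-invariant class (`g^{2^J}Q − Q − w` is `2^J`-torsion for the `w ∈ A ⊆ E(ℚ_{v,∞})`
of the hypothesis, and `N` fixes `w`), so it extends over `U_J` by `exists_resSubgroup_eq_of_conjMap_eq_of_padicInt` for the layer
character `κ_J`. [cite: BDKim2007, Prop. 3.15 (proof)] [cite: GreenbergLNM1716, §4 p. 124] [cite: SerreGaloisCohomology1997, I §2.6 (b)] -/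
theorem exists_layerCocycle_of_layerFixed (W : WeierstrassCurve ℚ) [W.IsElliptic] (κ : ZpExtension ℚ 2) (J : ℕ)
    (v : HeightOneSpectrum (𝓞 ℚ)) {g : absoluteGaloisGroup (v.adicCompletion ℚ)}
    (hg : κ.IsTopGenerator (resGalOfEmb (closureEmb (K := ℚ) (v.adicCompletion ℚ)) g))
    {b : localPoints W (v.adicCompletion ℚ)} (hb : b ∈ ⨆ n, signedLocalPoints κ (v.adicCompletion ℚ) W 1 n)
    (hfix : ∃ w ∈ (⨆ n, signedLocalPoints κ (v.adicCompletion ℚ) W 1 n), g ^ (2 ^ J) • b - b = 2 ^ J • w) :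
    ∃ (ψ : contOneCocycles (subgroupRep (LayerPairing.torsionLocalRep W (2 ^ J) v) (LayerPairing.layerGroup κ v J)))
      (Q : localPoints W (v.adicCompletion ℚ)), 2 ^ J • Q = b ∧
      ∀ (τ : absoluteGaloisGroup (v.adicCompletion ℚ)) (hτ : τ ∈ localSubgroup κ.kerSubgroup (v.adicCompletion ℚ)),
        pointsMap W (v.adicCompletion ℚ) ((ψ.1 ⟨τ, kerLocal_le_layerGroup κ v J hτ⟩ : W.geomTorsion ((2 ^ J : ℕ) : ℤ)) :
          W.geomPoints) = τ • Q - Q := by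
  haveI : Fact (Nat.Prime 2) := ⟨Nat.prime_two⟩
  let U : Subgroup (absoluteGaloisGroup (v.adicCompletion ℚ)) := LayerPairing.layerGroup κ v J
  let N : Subgroup (absoluteGaloisGroup (v.adicCompletion ℚ)) := localSubgroup κ.kerSubgroup (v.adicCompletion ℚ)
  haveI hNnormal : N.Normal := by
    change (localSubgroup κ.kerSubgroup (v.adicCompletion ℚ)).Normal
    rw [localSubgroup_eq_comap]; infer_instance
  have hNU : N ≤ U := kerLocal_le_layerGroup κ v J
  set A : AddSubgroup (localPoints W (v.adicCompletion ℚ)) := ⨆ n, signedLocalPoints κ (v.adicCompletion ℚ) W 1 n with hAdef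
  haveI : CompactSpace (absoluteGaloisGroup (v.adicCompletion ℚ)) := absoluteGaloisGroup_compactSpace (v.adicCompletion ℚ)
  haveI : CompactSpace U := isCompact_iff_compactSpace.mp
    ((Subgroup.isClosed_of_isOpen U (LayerPairing.isOpen_layerGroup κ v J)).isCompact)
  let n : ℤ := ((2 ^ J : ℕ) : ℤ)
  have hn : n ≠ 0 := by
    change ((2 ^ J : ℕ) : ℤ) ≠ 0
    exact_mod_cast pow_ne_zero J two_ne_zero
  let B := W.geomTorsion n
  let ρ₀ : ContinuousRep (absoluteGaloisGroup (v.adicCompletion ℚ)) ℤ B := GaloisRep.restrictField (v.adicCompletion ℚ) (W.torsionGaloisModule n)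
  -- the restriction of `E[2^J]|` to `U_J`, as a continuous representation of the group `U_J`
  let τU : ContinuousRep U ℤ B := ρ₀.restrict (subgroupSubtypeHom U)
  have hρU : ∀ (x : U) (m : B), τU.toTopRep.ρ x m = ρ₀ (x : absoluteGaloisGroup (v.adicCompletion ℚ)) m := fun _ _ ↦ rfl
  let N' : Subgroup U := N.subgroupOf U
  let ι : B → localPoints W (v.adicCompletion ℚ) := fun t ↦ pointsMap W (v.adicCompletion ℚ) (t : W.geomPoints)
  let θ : B ≃+ AddSubgroup.torsionBy (localPoints W (v.adicCompletion ℚ)) n := W.torsionPointsEquiv n (E := v.adicCompletion ℚ) hn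
  have galois_smul_nsmul : ∀ (τ : absoluteGaloisGroup (v.adicCompletion ℚ)) (k : ℕ) (P : localPoints W (v.adicCompletion ℚ)), τ • (k • P) = k • (τ • P) :=
    fun τ k P ↦ map_nsmul (DistribSMul.toAddMonoidHom (localPoints W (v.adicCompletion ℚ)) τ) k P
  have hιinj : Function.Injective ι := fun a c hac ↦ θ.injective (Subtype.ext hac)
  have hιadd : ∀ a c : B, ι (a + c) = ι a + ι c := fun a c ↦ by
    change pointsMap W _ ((a : W.geomPoints) + c) = _; rw [map_add]
  have hιsub : ∀ a c : B, ι (a - c) = ι a - ι c := fun a c ↦ by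
    change pointsMap W _ ((a : W.geomPoints) - c) = _; rw [map_sub]
  have hιnsmul : ∀ (c : ℕ) (a : B), ι (c • a) = c • ι a := fun c a ↦ by
    change pointsMap W _ (((c • a : B) : W.geomPoints)) = _
    rw [AddSubgroupClass.coe_nsmul, map_nsmul]
  have hιgal : ∀ (σ : absoluteGaloisGroup (v.adicCompletion ℚ)) (a : B), ι (resGal (K := ℚ) (v.adicCompletion ℚ) σ • a) = σ • ι a := fun σ a ↦ by
    change pointsMap W _ (((resGal (K := ℚ) (v.adicCompletion ℚ) σ • a : B) : W.geomPoints)) = _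
    rw [Literature.NumberTheory.EllipticCurves.AddSubgroup.torsionBy.coe_smul, pointsMap_smul]
  have hιθsymm : ∀ T : AddSubgroup.torsionBy (localPoints W (v.adicCompletion ℚ)) n, ι (θ.symm T) = T := fun T ↦ W.pointsMap_torsionPointsEquiv_symm n hn T
  have hρ : ∀ (σ : absoluteGaloisGroup (v.adicCompletion ℚ)) (m : B), ρ₀ σ m = resGal (K := ℚ) (v.adicCompletion ℚ) σ • m := fun σ m ↦ by
    change W.torsionGaloisModule n (resGal (K := ℚ) (v.adicCompletion ℚ) σ) m = _
    rw [torsionGaloisModule_apply_apply]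
  have hρN' : ∀ (x : N') (m : B), (subgroupRep τU.toTopRep N').ρ x m = ρ₀ ((x : U) : absoluteGaloisGroup (v.adicCompletion ℚ)) m :=
    fun x m ↦ by rw [subgroupRep_ρ_apply, hρU]
  have hρN : ∀ (x : N) (m : B),
      (subgroupRep (DiscreteGaloisModule.toTopRep (GaloisRep.restrictField (v.adicCompletion ℚ) (W.torsionGaloisModule n))) N).ρ x m =
        ρ₀ (x : absoluteGaloisGroup (v.adicCompletion ℚ)) m := fun _ _ ↦ rfl
  have hρX₀U : ∀ (x : U) (m : B), (subgroupRep (LayerPairing.torsionLocalRep W (2 ^ J) v) U).ρ x m = ρ₀ (x : absoluteGaloisGroup (v.adicCompletion ℚ)) m :=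
    fun _ _ ↦ rfl
  have hAtower : A ≤ localTowerPointsOfEmb κ (closureEmb (K := ℚ) (v.adicCompletion ℚ)) W :=
    PlusDualTwo.iSup_signedLocalPoints_le_localTowerPointsOfEmb W κ v
  have h2J : ∀ P : localPoints W (v.adicCompletion ℚ), n • P = 2 ^ J • P := fun P ↦ natCast_zsmul P (2 ^ J)
  -- the root `Q` of `b` and its Kummer cocycle on `N`
  let Q : localPoints W (v.adicCompletion ℚ) := W.subgroupZSMulRoot n hn b
  have hQb : 2 ^ J • Q = b := by rw [← h2J]; exact W.zsmul_subgroupZSMulRoot n hn b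
  have hQN : n • Q ∈ FixedPoints.addSubgroup N (localPoints W (v.adicCompletion ℚ)) := by
    rw [h2J, hQb]; exact hAtower hb
  let κ₀ := W.subgroupKummerCocycle n N hn Q hQN
  have hκ₀ : ∀ τ : N, ι (κ₀.1 τ) = (τ : absoluteGaloisGroup (v.adicCompletion ℚ)) • Q - Q := fun τ ↦ W.pointsMap_subgroupKummerCocycle_apply n N hn Q hQN τ
  -- the same cocycle on `N' = N ∩ U_J ≤ U_J`, for `τU`
  obtain ⟨cQ, hcQv⟩ : ∃ cQ : contOneCocycles (subgroupRep τU.toTopRep N'),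
      ∀ a : N', cQ.1 a = κ₀.1 ⟨((a : U) : absoluteGaloisGroup (v.adicCompletion ℚ)), a.2⟩ :=
    ⟨⟨⟨fun a ↦ κ₀.1 ⟨((a : U) : absoluteGaloisGroup (v.adicCompletion ℚ)), a.2⟩,
      κ₀.1.continuous.comp ((continuous_subtype_val.comp continuous_subtype_val).subtype_mk _)⟩, fun a c ↦ by
      rw [hρN']
      have h := κ₀.2 ⟨((a : U) : absoluteGaloisGroup (v.adicCompletion ℚ)), a.2⟩ ⟨((c : U) : absoluteGaloisGroup (v.adicCompletion ℚ)), c.2⟩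
      rw [hρN] at h
      exact h⟩, fun _ ↦ rfl⟩
  have hcQ : ∀ a : N', ι (cQ.1 a) = ((a : U) : absoluteGaloisGroup (v.adicCompletion ℚ)) • Q - Q := fun a ↦ by
    rw [hcQv]; exact hκ₀ ⟨((a : U) : absoluteGaloisGroup (v.adicCompletion ℚ)), a.2⟩
  -- the torsion element controlling the `g^{2^J}`-invariance
  obtain ⟨w, hw, hwe⟩ := hfix
  have hwN : ∀ τ : absoluteGaloisGroup (v.adicCompletion ℚ), τ ∈ N → τ • w = w := (mem_localTowerPointsOfEmb_iff κ _ W w).1 (hAtower hw)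
  have hT : g ^ (2 ^ J) • Q - Q - w ∈ AddSubgroup.torsionBy (localPoints W (v.adicCompletion ℚ)) n := by
    refine (Submodule.mem_torsionBy_iff _ _).mpr ?_
    change n • (g ^ (2 ^ J) • Q - Q - w) = 0
    rw [h2J, smul_sub, smul_sub, ← galois_smul_nsmul, hQb, hwe, sub_self]
  let bT : B := θ.symm ⟨_, hT⟩
  have hιbT : ι bT = g ^ (2 ^ J) • Q - Q - w := hιθsymm ⟨_, hT⟩
  -- `g^{2^J} ∈ U_J`
  have hg1 : κ (resGal (K := ℚ) (v.adicCompletion ℚ) g) = Multiplicative.ofAdd 1 := by rw [resGal_eq]; exact hg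
  have hgU : g ^ (2 ^ J) ∈ U := by
    refine (mem_localSubgroupOfEmb_iff _ _ _).mpr ?_
    rw [← resGal_eq, ZpExtension.mem_layerSubgroup, map_pow, map_pow, hg1, ← ofAdd_nsmul, toAdd_ofAdd, nsmul_eq_mul, mul_one]
    exact ⟨1, by push_cast; ring⟩
  let γ' : U := ⟨g ^ (2 ^ J), hgU⟩
  -- the class of `cQ` is fixed by the conjugation by `g^{2^J}`
  have hinv : conjMap τU.toTopRep N' γ' 1 (oneCocycleClass _ cQ) = oneCocycleClass _ cQ := by
    rw [conjMap_oneCocycleClass, ← sub_eq_zero, ← oneCocycleClass_sub, oneCocycleClass_eq_zero_iff]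
    refine ⟨bT, fun a ↦ ?_⟩
    rw [Submodule.coe_sub, ContinuousMap.sub_apply, conj_pullback_apply, hρU, hρN']
    change ρ₀ (g ^ (2 ^ J)) (cQ.1 (subgroupConj N' γ' a)) - cQ.1 a = ρ₀ ((a : U) : absoluteGaloisGroup (v.adicCompletion ℚ)) bT - bT
    apply hιinj
    rw [hιsub, hρ, hιgal, hcQ, hcQ, hιsub, hρ, hιgal, hιbT]
    have hconj : (((subgroupConj N' γ' a : N') : U) : absoluteGaloisGroup (v.adicCompletion ℚ)) =
        (g ^ (2 ^ J))⁻¹ * ((a : U) : absoluteGaloisGroup (v.adicCompletion ℚ)) * g ^ (2 ^ J) := by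
      rw [subgroupConj_apply_coe, Subgroup.coe_mul, Subgroup.coe_mul, Subgroup.coe_inv]
    rw [hconj]
    have e5 : g ^ (2 ^ J) • (((g ^ (2 ^ J))⁻¹ * ((a : U) : absoluteGaloisGroup (v.adicCompletion ℚ)) * g ^ (2 ^ J)) • Q) = ((a : U) : absoluteGaloisGroup (v.adicCompletion ℚ)) • g ^ (2 ^ J) • Q := by
      rw [← mul_smul, ← mul_assoc, ← mul_assoc, mul_inv_cancel, one_mul, mul_smul]
    rw [smul_sub (g ^ (2 ^ J)), e5, smul_sub ((a : U) : absoluteGaloisGroup (v.adicCompletion ℚ)),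
      smul_sub ((a : U) : absoluteGaloisGroup (v.adicCompletion ℚ)), hwN _ (Subgroup.mem_subgroupOf.mp a.2)]
    abel
  -- the layer character and the `ℤ₂`-quotient `U_J/N`
  obtain ⟨κJ, hκJ⟩ := exists_layerCharacter κ v J
  have hpa : ((2 : ℤ_[2]) ^ J) ≠ 0 := pow_ne_zero _ (Nat.cast_ne_zero.mpr two_ne_zero)
  have hL : ∀ a : U, a ∈ N' ↔ κJ a = 1 := by
    intro a
    rw [Subgroup.mem_subgroupOf]
    change κ (resGal (K := ℚ) (v.adicCompletion ℚ) ((a : U) : absoluteGaloisGroup (v.adicCompletion ℚ))) = 1 ↔ _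
    constructor
    · intro h
      have h1 := hκJ a
      rw [h, toAdd_one, mul_eq_zero] at h1
      rcases h1 with h1 | h1
      · exact absurd h1 hpa
      · rw [← ofAdd_toAdd (κJ a), h1]; rfl
    · intro h
      have h1 := hκJ a
      rw [h, toAdd_one, mul_zero] at h1
      rw [← ofAdd_toAdd (κ _), ← h1]; rfl
  have hγ1 : κJ γ' = Multiplicative.ofAdd 1 := by
    have h1 := hκJ γ'
    change (2 : ℤ_[2]) ^ J * (κJ γ').toAdd = (κ (resGal (K := ℚ) (v.adicCompletion ℚ) (g ^ (2 ^ J)))).toAdd at h1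
    rw [map_pow, map_pow, hg1, ← ofAdd_nsmul, toAdd_ofAdd, nsmul_eq_mul, mul_one] at h1
    have h2 : (κJ γ').toAdd = 1 := mul_left_cancel₀ hpa (by rw [h1]; push_cast; ring)
    rw [← ofAdd_toAdd (κJ γ'), h2]
  have hBprim : ∀ t : B, ∃ e : ℕ, 2 ^ e • t = 0 := fun t ↦ ⟨J, W.pow_nsmul_geomTorsion_pow 2 J t⟩
  obtain ⟨xc, hxc⟩ := exists_resSubgroup_eq_of_conjMap_eq_of_padicInt τU hBprim κJ N' hL hγ1 (oneCocycleClass _ cQ) hinv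
  -- (destructuring existentials typed by `τU.toTopRep` with `rcases` is slow here; use `Classical.choose`)
  have hsurj := oneCocycleClass_surjective τU.toTopRep xc
  let ξ : contOneCocycles τU.toTopRep := Classical.choose hsurj
  have hξ : oneCocycleClass _ ξ = xc := Classical.choose_spec hsurj
  rw [← hξ] at hxc
  have hcob := exists_apply_eq_add_coboundary_of_resSubgroup_eq τU.toTopRep N' ξ cQ hxc
  let bb : B := Classical.choose hcob
  have hbb : ∀ a : N', ξ.1 (a : U) = cQ.1 a + ((subgroupRep τU.toTopRep N').ρ a bb - bb) := Classical.choose_spec hcob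
  -- the `U_J`-cocycle of the untwisted local module with the same values as `ξ`
  let ψ : contOneCocycles (subgroupRep (LayerPairing.torsionLocalRep W (2 ^ J) v) (LayerPairing.layerGroup κ v J)) :=
    contOneCocycles.pullback (ContinuousMonoidHom.id _) (X := τU.toTopRep)
      (Y := subgroupRep (LayerPairing.torsionLocalRep W (2 ^ J) v) (LayerPairing.layerGroup κ v J))
      (TopRep.ofHom ⟨ContinuousLinearMap.id ℤ B, fun _ => rfl⟩) ξ
  have hψ : ∀ σ, ψ.1 σ = ξ.1 σ := fun _ ↦ rfl
  have hιJ : ∀ t : B, 2 ^ J • ι t = 0 := fun t ↦ by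
    rw [← hιnsmul, W.pow_nsmul_geomTorsion_pow 2 J t]
    change pointsMap W _ ((0 : B) : W.geomPoints) = 0
    rw [ZeroMemClass.coe_zero, map_zero]
  refine ⟨ψ, Q + ι bb, by rw [smul_add, hQb, hιJ bb, add_zero], fun τ hτ ↦ ?_⟩
  have hτ' : (⟨τ, hNU hτ⟩ : U) ∈ N' := (Subgroup.mem_subgroupOf).mpr hτ
  have h := hbb ⟨⟨τ, hNU hτ⟩, hτ'⟩
  rw [hρN'] at h
  change ξ.1 ⟨τ, hNU hτ⟩ = cQ.1 ⟨⟨τ, hNU hτ⟩, hτ'⟩ + (ρ₀ τ bb - bb) at h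
  change ι (ψ.1 ⟨τ, hNU hτ⟩) = _
  rw [hψ, h, hιadd, hιsub, hρ, hιgal, hcQ, smul_add]
  change τ • Q - Q + (τ • ι bb - ι bb) = τ • Q + τ • ι bb - (Q + ι bb)
  abel

end Summit.BirchSwinnertonDyer.BirchSwinnertonDyer.Theorems.SignedEC.TwistedLocalKummer

end
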